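import Mathlib.Analysis.SpecialFunctions.Pow.Real
import Mathlib.Algebra.BigOperators.Intervals
import Literature.Algebra.PolynomialIdentities.WeightedAverages
import HarnessLib

/-!
# [IUTchIV] Theorem 1.10, Steps (v)–(viii): the averaging — weighted averages over collections
# (Prop. 1.7), procession averages over `j` ((E1), (E2)), and the sum over `v_ℚ`

Mochizuki, *Inter-universal Teichmüller theory IV*, RIMS manuscript (Apr. 2020; = PRIMS **57** (2021)),
proof of Theorem 1.10, Steps (iv)–(viii), pp. 26–30. TAKES NO SIDE on the disputed step: the only input
is a real number `−|log(Θ)|` together with an UPPER BOUND for it of the printed shape (hypothesis `h` of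
`hull_bound_of_local_bounds`); nothing about Θ-pilots is asserted.

What this file does. Step (iv) (p. 26–27) says how the log-volume to be bounded is organised: "we
proceed to estimate this log-volume at each `v_ℚ ∈ 𝕍_ℚ`. Once one fixes `v_ℚ`, this amounts to estimating
the component of this log-volume in “`ℐ^ℚ(^{S±_{j+1}};_{n,∘}𝒟^⊢_{v_ℚ})`” … for each `j ∈ {1, …, l⋇}` … and
then computing the average, over `j ∈ {1, …, l⋇}`, of these estimates … for each collection
`{v_i}_{i ∈ S±_{j+1}}` of [not necessarily distinct!] elements of `𝕍(F_mod)_{v_ℚ}`, we must estimate the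
component … and then compute the weighted average [cf. … Remark 1.7.1], over possible collections
`{v_i}_{i ∈ S±_{j+1}}`, of these estimates" (`S±_{j+1} = {0, 1, …, j}`). This file takes the printed
PER-COLLECTION upper bounds of Steps (v), (vi), (vii) as inputs — at a distinguished `v_ℚ`:
"`(−λ + d_I + 1)·log(p) + 4(j+1)·l*_mod`" (p. 28, from Prop. 1.4 (iii) and (R4); with the factor
`ι_{v_ℚ}` of Step (iii) recording whether `p_{v_ℚ} ≤ e*_mod·l`); at a non-distinguished nonarchimedean
`v_ℚ`: "`0`" (p. 29, Prop. 1.4 (iv)); at the archimedean prime: "`(j+1)·log(π)`" (p. 30, Prop. 1.5) — and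
PROVES all the averaging and summation the text then performs:
* `wavg_collBound_eq` / `wavg_tupleBeta_betaE_eq` — Prop. 1.7 applied exactly as on p. 28 (the choices
  of "`E`", "`n = j+1`", "`λ_e = [(F_mod)_v : ℚ_{v_ℚ}]`", "`β_e = log(𝔡^K_v) − j²/(2l(j+1))·log(q_v) +
  (1/(j+1))·log(p_{v_ℚ}) + 4·ι_{v_ℚ}·l*_mod`"): the "weighted average upper bound" equals
  `(j+1)·log(𝔡^K_{v_ℚ}) − (j²/2l)·log(q_{v_ℚ}) + log(𝔰^ℚ_{v_ℚ}) + 4(j+1)·l*_mod·log(𝔰^≤_{v_ℚ})` (final display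
  of p. 28), and "symmetrizing with respect to the choice of `i† ∈ I` … does not affect the computation";
* `procAvg_linear` — "averaging over `j ∈ {1, …, l⋇ = (l−1)/2}` and applying (E1), (E2), we obtain the
  procession-normalized upper bound `(l⋇+3)/2·log(𝔡^K_{v_ℚ}) − (2l⋇+1)(l⋇+1)/(12l)·log(q_{v_ℚ}) +
  log(𝔰^ℚ_{v_ℚ}) + 2(l⋇+3)·l*_mod·log(𝔰^≤_{v_ℚ}) = (l+5)/4·… − (l+1)/24·… + … + (l+5)·…`" (p. 29);
* `procNormalized_le` — "`≤ (l+1)/4·{(1 + 4/l)·log(𝔡^K_{v_ℚ}) − (1/6)·log(q_{v_ℚ}) + (4/l)·log(𝔰^ℚ_{v_ℚ}) +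
  (20/3)·l*_mod·log(𝔰^≤_{v_ℚ})}` — where … we apply the estimates `1/(l+1) ≤ 1/l` and `4(l+5)/(l+1) ≤ 20/3`
  … `l ≥ 5`" (p. 29);
* `procAvg_arch` — Step (vii): the procession-normalized archimedean bound is `(l+5)/4·log(π)` (p. 30);
* `hull_bound_of_local_bounds` — Step (viii), first sentence (p. 30): summing over `v_ℚ ∈ 𝕍_ℚ` gives the
  global bound `(l+1)/4·{(1 + 4/l)·Σ log(𝔡^K_{v_ℚ}) − (1/6)·Σ log(q_{v_ℚ}) + (4/l)·Σ log(𝔰^ℚ_{v_ℚ}) +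
  (20/3)·l*_mod·Σ log(𝔰^≤_{v_ℚ})} + (l+5)/4·log(π)` — exactly the shape of the field `hull_le` of
  `Literature.IUT.LogVolume.Thm110Numerics.ProofData` (file `Theorem110.lean`, not imported here so that
  the two files land independently; the identification `Σ_{v_ℚ} log(𝔡^K_{v_ℚ}) = log(𝔡^K)` etc. is
  Def. 1.9 bookkeeping of arithmetic divisors, done where those divisors are defined).

(E1) `(1/n)·Σ_{m=1}^{n} m = (n+1)/2` and (E2) `(1/n)·Σ_{m=1}^{n} m² = (2n+1)(n+1)/6` (Step (i), p. 23) are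
`avg_id_eq` and `avg_sq_eq`.

Deliberately NOT here: the per-collection bounds themselves (Props. 1.4, 1.5, (R4)), the definition of the
procession-normalized mono-analytic log-volume ([IUTchIII] Prop. 3.9), arithmetic divisors (Def. 1.9).
-/

noncomputable section

namespace Literature.IUT.LogVolume

open Finset Literature.Algebra.PolynomialIdentities.WeightedAverage

namespace Thm110Local

/-! ## (E1), (E2) and procession averages over `j ∈ {1, …, l⋇}` -/

/-- `Σ_{m=1}^{n} m = n(n+1)/2` (real form). [folklore] -/
private theorem sum_Icc_id (n : ℕ) : ∑ m ∈ Icc 1 n, (m : ℝ) = n * (n + 1) / 2 := by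
  induction n with
  | zero => simp
  | succ k ih =>
    rw [Finset.sum_Icc_succ_top (by omega), ih]; push_cast; ring

/-- `Σ_{m=1}^{n} m² = n(n+1)(2n+1)/6` (real form). [folklore] -/
private theorem sum_Icc_sq (n : ℕ) : ∑ m ∈ Icc 1 n, ((m : ℝ) ^ 2) = n * (n + 1) * (2 * n + 1) / 6 := by
  induction n with
  | zero => simp
  | succ k ih =>
    rw [Finset.sum_Icc_succ_top (by omega), ih]; push_cast; ring

/-- **(E1)** ([IUTchIV] proof of Thm 1.10, Step (i), p. 23): `(1/n)·Σ_{m=1}^{n} m = (n+1)/2` for `n ≥ 1`.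
[claim: Mochizuki2012, status: disputed] -/
theorem avg_id_eq {n : ℕ} (hn : 1 ≤ n) : 1 / (n : ℝ) * ∑ m ∈ Icc 1 n, (m : ℝ) = ((n : ℝ) + 1) / 2 := by
  rw [sum_Icc_id]
  have : (n : ℝ) ≠ 0 := by exact_mod_cast (show n ≠ 0 by omega)
  field_simp

/-- **(E2)** ([IUTchIV] proof of Thm 1.10, Step (i), p. 23): `(1/n)·Σ_{m=1}^{n} m² = (2n+1)(n+1)/6` for
`n ≥ 1`. [claim: Mochizuki2012, status: disputed] -/
theorem avg_sq_eq {n : ℕ} (hn : 1 ≤ n) :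
    1 / (n : ℝ) * ∑ m ∈ Icc 1 n, ((m : ℝ) ^ 2) = (2 * (n : ℝ) + 1) * ((n : ℝ) + 1) / 6 := by
  rw [sum_Icc_sq]
  have : (n : ℝ) ≠ 0 := by exact_mod_cast (show n ≠ 0 by omega)
  field_simp

/-- The procession average over `j ∈ {1, …, l⋇}`: `(1/l⋇)·Σ_{j=1}^{l⋇} f(j)` ("computing the average, over
`j ∈ {1, …, l⋇}`, of these estimates", Step (iv), p. 27). [claim: Mochizuki2012, status: disputed] -/
def procAvg (lh : ℕ) (f : ℕ → ℝ) : ℝ := 1 / (lh : ℝ) * ∑ j ∈ Icc 1 lh, f j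

/-- Step (v), p. 29, "by averaging over `j ∈ {1, …, l⋇}` and applying (E1), (E2)": for constants
`A, B, C, D`, `(1/l⋇)·Σ_{j=1}^{l⋇} [(j+1)·A − (j²/(2l))·B + C + 4(j+1)·D] = (l⋇+3)/2·A − (2l⋇+1)(l⋇+1)/(12l)·B
+ C + 2(l⋇+3)·D`. [claim: Mochizuki2012, status: disputed] -/
theorem procAvg_linear {lh : ℕ} (hlh : 1 ≤ lh) (l A B C D : ℝ) :
    procAvg lh (fun j => ((j : ℝ) + 1) * A - (j : ℝ) ^ 2 / (2 * l) * B + C + 4 * ((j : ℝ) + 1) * D) =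
      ((lh : ℝ) + 3) / 2 * A - (2 * (lh : ℝ) + 1) * ((lh : ℝ) + 1) / (12 * l) * B + C
        + 2 * ((lh : ℝ) + 3) * D := by
  unfold procAvg
  have hn : (lh : ℝ) ≠ 0 := by exact_mod_cast (show lh ≠ 0 by omega)
  have e1 := sum_Icc_id lh
  have e2 := sum_Icc_sq lh
  have hcard : ∑ _j ∈ Icc 1 lh, (1 : ℝ) = lh := by simp
  -- split the sum into its three base sums `Σ j`, `Σ j²`, `Σ 1`
  have hlin : ∀ j : ℕ, ((j : ℝ) + 1) * A - (j : ℝ) ^ 2 / (2 * l) * B + C + 4 * ((j : ℝ) + 1) * D =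
      (A + 4 * D) * (j : ℝ) + (-(B / (2 * l))) * (j : ℝ) ^ 2 + (A + C + 4 * D) * 1 := by
    intro j; ring
  simp_rw [hlin]
  rw [Finset.sum_add_distrib, Finset.sum_add_distrib, ← Finset.mul_sum, ← Finset.mul_sum,
    ← Finset.mul_sum, e1, e2, hcard]
  field_simp
  ring

/-- With `l = 2l⋇ + 1` the procession-normalized coefficients are the printed ones (p. 29):
`(l⋇+3)/2 = (l+5)/4`, `(2l⋇+1)(l⋇+1)/(12l) = (l+1)/24`, `2(l⋇+3) = l+5`.
[claim: Mochizuki2012, status: disputed] -/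
theorem procAvg_linear' {lh : ℕ} (hlh : 1 ≤ lh) (A B C D : ℝ) :
    procAvg lh (fun j => ((j : ℝ) + 1) * A - (j : ℝ) ^ 2 / (2 * (2 * (lh : ℝ) + 1)) * B + C
        + 4 * ((j : ℝ) + 1) * D) =
      ((2 * (lh : ℝ) + 1) + 5) / 4 * A - ((2 * (lh : ℝ) + 1) + 1) / 24 * B + C
        + ((2 * (lh : ℝ) + 1) + 5) * D := by
  rw [procAvg_linear hlh]
  have : (2 * (lh : ℝ) + 1) ≠ 0 := by positivity
  field_simp
  ring

/-- Step (v), last inequality of the final display (p. 29): for `A, C, D ≥ 0` and `l ≥ 5`,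
`(l+5)/4·A − (l+1)/24·B + C + (l+5)·D ≤ (l+1)/4·{(1 + 4/l)·A − (1/6)·B + (4/l)·C + (20/3)·D}` — "where … we
apply the estimates `1/(l+1) ≤ 1/l` and `4(l+5)/(l+1) ≤ 20/3`, both … consequences of the fact that `l ≥ 5`".
[claim: Mochizuki2012, status: disputed] -/
theorem procNormalized_le {l A B C D : ℝ} (hl : 5 ≤ l) (hA : 0 ≤ A) (hC : 0 ≤ C) (hD : 0 ≤ D) :
    (l + 5) / 4 * A - (l + 1) / 24 * B + C + (l + 5) * D ≤
      (l + 1) / 4 * ((1 + 4 / l) * A - 1 / 6 * B + 4 / l * C + 20 / 3 * D) := by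
  have hl0 : 0 < l := by linarith
  -- coefficient of `A`: `(l+5)/4 ≤ (l+1)/4·(1+4/l) = (l+5+4/l)/4`
  have hA' : (l + 5) / 4 * A ≤ (l + 1) / 4 * ((1 + 4 / l) * A) := by
    have : (l + 5) / 4 ≤ (l + 1) / 4 * (1 + 4 / l) := by
      have h4 : 0 ≤ 4 / l * ((l + 1) / 4) := by positivity
      nlinarith [show (l + 1) / 4 * (1 + 4 / l) = (l + 5) / 4 + (4 / l) * (1 / 4) by field_simp; ring]
    nlinarith
  -- coefficient of `C`: `1 ≤ (l+1)/4·(4/l) = (l+1)/l`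
  have hC' : C ≤ (l + 1) / 4 * (4 / l * C) := by
    have : (1 : ℝ) ≤ (l + 1) / 4 * (4 / l) := by
      rw [show (l + 1) / 4 * (4 / l) = (l + 1) / l by field_simp]
      rw [le_div_iff₀ hl0]; linarith
    nlinarith
  -- coefficient of `D`: `l+5 ≤ (l+1)/4·(20/3) = 5(l+1)/3 ⟺ 3l+15 ≤ 5l+5 ⟺ l ≥ 5`
  have hD' : (l + 5) * D ≤ (l + 1) / 4 * (20 / 3 * D) := by nlinarith
  -- coefficient of `B`: equality
  have hB' : (l + 1) / 24 * B = (l + 1) / 4 * (1 / 6 * B) := by ring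
  nlinarith

/-- Step (vii) (p. 30): the procession average of the archimedean per-collection bound `(j+1)·log(π)` is
`(l⋇+3)/2·log(π) = (l+5)/4·log(π)` "— cf. (E1)". [claim: Mochizuki2012, status: disputed] -/
theorem procAvg_arch {lh : ℕ} (hlh : 1 ≤ lh) (c : ℝ) :
    procAvg lh (fun j => ((j : ℝ) + 1) * c) = ((2 * (lh : ℝ) + 1) + 5) / 4 * c := by
  have h := procAvg_linear' hlh c 0 0 0
  have e : (fun j : ℕ => ((j : ℝ) + 1) * c - (j : ℝ) ^ 2 / (2 * (2 * (lh : ℝ) + 1)) * 0 + 0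
      + 4 * ((j : ℝ) + 1) * 0) = fun j : ℕ => ((j : ℝ) + 1) * c := by
    funext j; ring
  rw [e] at h
  rw [h]; ring

/-- Step (vi) (p. 29): at a non-distinguished nonarchimedean `v_ℚ` every per-collection bound is `0`, so
"the resulting procession-normalized upper bound is clearly equal to `0`". [claim: Mochizuki2012, status: disputed] -/
theorem procAvg_zero (lh : ℕ) : procAvg lh (fun _ => 0) = 0 := by
  simp [procAvg]

/-! ## Weighted averages over collections at one distinguished `v_ℚ` (Step (v), pp. 27–28) -/

variable {E : Type*} [Fintype E] [Nonempty E]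

/-- The local data at one `v_ℚ ∈ 𝕍_ℚ^dst` (Step (v)): `E = 𝕍(F_mod)_{v_ℚ}`; for `v ∈ E`, the weight
`λ_v = [(F_mod)_v : ℚ_{v_ℚ}] ∈ ℝ_{>0}`, `log(𝔡^K_v) ≥ 0` (the normalized `v`-degree of the different of `K`,
`= d_v·log(p_{v_ℚ})` in the notation of Prop. 1.4), `log(q_v) ≥ 0` (`= 0` if `v ∈ 𝕍^good`); and the two
`v_ℚ`-constants `log(p_{v_ℚ}) (= log(𝔰^ℚ_{v_ℚ}))` and `ι_{v_ℚ} (= log(𝔰^≤_{v_ℚ})) ≥ 0`.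
[claim: Mochizuki2012, status: disputed] -/
structure DstLocal (E : Type*) [Fintype E] where
  /-- `λ_v = [(F_mod)_v : ℚ_{v_ℚ}]` -/
  lam : E → ℝ
  /-- `λ_v > 0` -/
  lam_pos : ∀ v, 0 < lam v
  /-- `log(𝔡^K_v)` -/
  logDK : E → ℝ
  /-- `log(𝔡^K_v) ≥ 0` -/
  logDK_nonneg : ∀ v, 0 ≤ logDK v
  /-- `log(q_v)` -/
  logQ : E → ℝ
  /-- `log(q_v) ≥ 0` -/
  logQ_nonneg : ∀ v, 0 ≤ logQ v
  /-- `log(p_{v_ℚ}) = log(𝔰^ℚ_{v_ℚ})` -/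
  logp : ℝ
  /-- `log(p_{v_ℚ}) ≥ 0` -/
  logp_nonneg : 0 ≤ logp
  /-- `ι_{v_ℚ} = log(𝔰^≤_{v_ℚ})` (`1` if `p_{v_ℚ} ≤ e*_mod·l`, else `0`) -/
  iota : ℝ
  /-- `ι_{v_ℚ} ≥ 0` -/
  iota_nonneg : 0 ≤ iota

namespace DstLocal

variable (D : DstLocal E)

/-- The weighted average over collections `e⃗ ∈ E^n` of a per-collection quantity `B`, with the weights
`λ_Πe⃗ / Σ λ_Πe⃗` of Remark 1.7.1 / Prop. 1.7: `(Σ_{e⃗} B(e⃗)·λ_Πe⃗)/(Σ_{e⃗} λ_Πe⃗)`.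
[claim: Mochizuki2012, status: disputed] -/
def wavg (n : ℕ) (B : (Fin n → E) → ℝ) : ℝ :=
  (∑ e : Fin n → E, B e * tupleLam D.lam e) / (∑ e : Fin n → E, tupleLam D.lam e)

/-- The `λ`-weighted average over `v ∈ E` of a per-valuation quantity, `β_avg = β_E/λ_E` of Prop. 1.7;
e.g. `log(𝔡^K_{v_ℚ})` is the `λ`-average of the `log(𝔡^K_v)`, `log(q_{v_ℚ})` that of the `log(q_v)`
(Def. 1.9 (ii)). [claim: Mochizuki2012, status: disputed] -/
def avg (f : E → ℝ) : ℝ := betaAvg f D.lam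

/-- The per-collection upper bound of Step (v) at `j`, for the collection `e⃗ = (v_0, …, v_j)` with
distinguished index `i† = j` (p. 27–28): "`(−λ + d_I + 1)·log(p) + 4(j+1)·l*_mod`", i.e.
`Σ_i log(𝔡^K_{v_i}) − (j²/(2l))·log(q_{v_j}) + log(p_{v_ℚ}) + 4(j+1)·ι_{v_ℚ}·l*_mod` ("“λ” to be `0` if
`v_j ∈ 𝕍^good`; … “ord(−)” of the element `q_{v_j}^{j²}` … if `v_j ∈ 𝕍^bad`"; the term `4(j+1)·l*_mod` is
present exactly when `p_{v_ℚ} ≤ e*_mod·l`, by (R4)). [claim: Mochizuki2012, status: disputed] -/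
def collBound (l lstar : ℝ) (j : ℕ) (e : Fin (j + 1) → E) : ℝ :=
  (∑ i, D.logDK (e i)) - (j : ℝ) ^ 2 / (2 * l) * D.logQ (e (Fin.last j)) + D.logp
    + 4 * ((j : ℝ) + 1) * D.iota * lstar

/-- The symmetrized per-valuation quantity "`β_e`" of p. 28: for `e ∈ E` corresponding to `v`,
`β_e = log(𝔡^K_v) − j²/(2l(j+1))·log(q_v) + (1/(j+1))·log(p_{v_ℚ}) + 4·ι_{v_ℚ}·l*_mod`.
[claim: Mochizuki2012, status: disputed] -/
def betaE (l lstar : ℝ) (j : ℕ) : E → ℝ := fun v =>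
  D.logDK v - (j : ℝ) ^ 2 / (2 * l * ((j : ℝ) + 1)) * D.logQ v + D.logp / ((j : ℝ) + 1)
    + 4 * D.iota * lstar

/-- The denominator `Σ_{e⃗} λ_Πe⃗` is positive. [folklore] -/
private theorem den_pos (n : ℕ) : 0 < ∑ e : Fin n → E, tupleLam D.lam e :=
  Finset.sum_pos (fun e _ => Finset.prod_pos fun i _ => D.lam_pos (e i)) Finset.univ_nonempty

/-- Weighted average of a symmetric sum `Σ_i f(v_i)`: `(j+1)·avg(f)` (first equality of Prop. 1.7).
[folklore] -/
private theorem wavg_sum_eq (f : E → ℝ) (j : ℕ) :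
    D.wavg (j + 1) (fun e => ∑ i, f (e i)) = ((j : ℝ) + 1) * D.avg f := by
  have h := (weightedAverage_eq f D.lam D.lam_pos j (Fin.last j)).1
  unfold wavg avg
  have e : (fun e : Fin (j + 1) → E => (∑ i, f (e i)) * tupleLam D.lam e) =
      fun e => tupleBeta f e * tupleLam D.lam e := by
    funext e; rfl
  rw [e, h]; push_cast; ring

/-- Weighted average of an `i`-th coordinate quantity `f(v_i)`: `avg(f)` (second equality of Prop. 1.7,
divided by `n`). [folklore] -/
private theorem wavg_coord_eq (f : E → ℝ) (j : ℕ) (i : Fin (j + 1)) :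
    D.wavg (j + 1) (fun e => f (e i)) = D.avg f := by
  have h := (weightedAverage_eq f D.lam D.lam_pos j i).2
  unfold wavg avg
  have hn : ((j + 1 : ℕ) : ℝ) ≠ 0 := by positivity
  have e : (∑ e : Fin (j + 1) → E, ((j + 1 : ℕ) : ℝ) * f (e i) * tupleLam D.lam e) =
      ((j + 1 : ℕ) : ℝ) * ∑ e : Fin (j + 1) → E, f (e i) * tupleLam D.lam e := by
    rw [Finset.mul_sum]; refine Finset.sum_congr rfl fun e _ => ?_; ring
  rw [e, mul_div_assoc] at h
  exact mul_left_cancel₀ hn h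

/-- Weighted average of a constant: the constant. [folklore] -/
private theorem wavg_const (n : ℕ) (c : ℝ) : D.wavg n (fun _ => c) = c := by
  unfold wavg
  rw [← Finset.mul_sum, mul_div_assoc, div_self (D.den_pos n).ne', mul_one]

omit [Nonempty E] in
/-- `wavg` is linear: sums. [folklore] -/
private theorem wavg_add (n : ℕ) (B₁ B₂ : (Fin n → E) → ℝ) :
    D.wavg n (fun e => B₁ e + B₂ e) = D.wavg n B₁ + D.wavg n B₂ := by
  unfold wavg
  rw [← add_div, ← Finset.sum_add_distrib]
  congr 1; refine Finset.sum_congr rfl fun e _ => ?_; ring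

omit [Nonempty E] in
/-- `wavg` is linear: differences. [folklore] -/
private theorem wavg_sub (n : ℕ) (B₁ B₂ : (Fin n → E) → ℝ) :
    D.wavg n (fun e => B₁ e - B₂ e) = D.wavg n B₁ - D.wavg n B₂ := by
  unfold wavg
  rw [← sub_div, ← Finset.sum_sub_distrib]
  congr 1; refine Finset.sum_congr rfl fun e _ => ?_; ring

omit [Nonempty E] in
/-- `wavg` is linear: scalars. [folklore] -/
private theorem wavg_smul (n : ℕ) (c : ℝ) (B : (Fin n → E) → ℝ) :
    D.wavg n (fun e => c * B e) = c * D.wavg n B := by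
  unfold wavg
  have h : ∑ e : Fin n → E, c * B e * tupleLam D.lam e = c * ∑ e : Fin n → E, B e * tupleLam D.lam e := by
    rw [Finset.mul_sum]; exact Finset.sum_congr rfl fun e _ => by ring
  show (∑ e : Fin n → E, c * B e * tupleLam D.lam e) / _ = _
  rw [h, mul_div_assoc]

/-- `wavg` is monotone (the weights are positive). [folklore] -/
private theorem wavg_mono (n : ℕ) {B₁ B₂ : (Fin n → E) → ℝ} (h : ∀ e, B₁ e ≤ B₂ e) :
    D.wavg n B₁ ≤ D.wavg n B₂ := by
  unfold wavg
  apply div_le_div_of_nonneg_right _ (D.den_pos n).le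
  refine Finset.sum_le_sum fun e _ => mul_le_mul_of_nonneg_right (h e) ?_
  exact (Finset.prod_pos fun i _ => D.lam_pos (e i)).le

/-- **Step (v), the "weighted average upper bound" (final display of p. 28)**: "by applying Proposition
1.7, we obtain that the resulting “weighted average upper bound” is given by `(j+1)·log(𝔡^K_{v_ℚ}) −
(j²/2l)·log(q_{v_ℚ}) + log(𝔰^ℚ_{v_ℚ}) + 4(j+1)·l*_mod·log(𝔰^≤_{v_ℚ})`" — here for the per-collection bound with
the distinguished index `i† = j` (no symmetrization needed: the `i†`-coordinate term averages to
`avg(log q)` by the second equality of Prop. 1.7). [claim: Mochizuki2012, status: disputed] -/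
theorem wavg_collBound_eq (l lstar : ℝ) (j : ℕ) :
    D.wavg (j + 1) (D.collBound l lstar j) =
      ((j : ℝ) + 1) * D.avg D.logDK - (j : ℝ) ^ 2 / (2 * l) * D.avg D.logQ + D.logp
        + 4 * ((j : ℝ) + 1) * D.iota * lstar := by
  have h1 := D.wavg_sum_eq D.logDK j
  have h2 := D.wavg_coord_eq D.logQ j (Fin.last j)
  have h3 := D.wavg_const (j + 1) (D.logp + 4 * ((j : ℝ) + 1) * D.iota * lstar)
  have e : D.collBound l lstar j = fun e =>
      ((∑ i, D.logDK (e i)) - (j : ℝ) ^ 2 / (2 * l) * D.logQ (e (Fin.last j)))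
        + (D.logp + 4 * ((j : ℝ) + 1) * D.iota * lstar) := by
    funext e; unfold collBound; ring
  rw [e, D.wavg_add, D.wavg_sub, D.wavg_smul, h1, h2, h3]
  ring

/-- "It follows immediately from the first equality of the first display of Proposition 1.7 that, after
passing to weighted averages, the operation of symmetrizing with respect to the choice of “`i† ∈ I`” in
`S±_{j+1}` does not affect the computation of the upper bound under consideration" (p. 28): the weighted
average of the symmetrized bound `β_{e⃗} = Σ_i β_{e_i}` is the same number. [claim: Mochizuki2012, status: disputed] -/
theorem wavg_tupleBeta_betaE_eq {l : ℝ} (hl : 0 < l) (lstar : ℝ) (j : ℕ) :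
    D.wavg (j + 1) (fun e => tupleBeta (D.betaE l lstar j) e) =
      ((j : ℝ) + 1) * D.avg D.logDK - (j : ℝ) ^ 2 / (2 * l) * D.avg D.logQ + D.logp
        + 4 * ((j : ℝ) + 1) * D.iota * lstar := by
  have h := D.wavg_sum_eq (D.betaE l lstar j) j
  unfold tupleBeta at h ⊢
  rw [h]
  -- `avg` is linear in `f`
  have hlin : D.avg (D.betaE l lstar j) = D.avg D.logDK
      - (j : ℝ) ^ 2 / (2 * l * ((j : ℝ) + 1)) * D.avg D.logQ + D.logp / ((j : ℝ) + 1)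
      + 4 * D.iota * lstar := by
    unfold avg betaAvg betaTotal
    have hden : lamTotal D.lam ≠ 0 := (lamTotal_pos D.lam_pos).ne'
    have hsum : ∑ e, D.betaE l lstar j e * D.lam e =
        (∑ e, D.logDK e * D.lam e) - (j : ℝ) ^ 2 / (2 * l * ((j : ℝ) + 1)) * (∑ e, D.logQ e * D.lam e)
          + (D.logp / ((j : ℝ) + 1) + 4 * D.iota * lstar) * lamTotal D.lam := by
      unfold lamTotal betaE
      rw [Finset.mul_sum, Finset.mul_sum, ← Finset.sum_sub_distrib, ← Finset.sum_add_distrib]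
      refine Finset.sum_congr rfl fun e _ => ?_; ring
    rw [hsum]
    field_simp
    ring
  rw [hlin]
  have hj : ((j : ℝ) + 1) ≠ 0 := by positivity
  field_simp

/-- **Step (v) at one distinguished `v_ℚ`, complete (pp. 27–29)**: if the component volumes
`vol(j, e⃗)` are bounded by the printed per-collection bounds, then their procession-normalized weighted
average is `≤ (l+1)/4·{(1 + 4/l)·log(𝔡^K_{v_ℚ}) − (1/6)·log(q_{v_ℚ}) + (4/l)·log(𝔰^ℚ_{v_ℚ}) +
(20/3)·l*_mod·log(𝔰^≤_{v_ℚ})}` (with `l = 2l⋇+1 ≥ 5`, `l*_mod ≥ 0`). [modelling: the PER-COLLECTION hypothesis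
`hvol` (bound with the `q`-term at the distinguished slot `i† = j`, BEFORE symmetrization) is STRONGER THAN
PRINT — the text asserts only the weighted-average form after symmetrizing in `i†` (p. 28); that printed form is
`procAvg_le_of_wavg_bounds` below, of which this theorem is a corollary. Referee finding B5-1 / c312-d1.]
[claim: Mochizuki2012, status: disputed] -/
theorem procAvg_wavg_le {lh : ℕ} (hlh : 2 ≤ lh) {lstar : ℝ} (hlstar : 0 ≤ lstar)
    (vol : (j : ℕ) → (Fin (j + 1) → E) → ℝ)
    (hvol : ∀ j, 1 ≤ j → j ≤ lh → ∀ e, vol j e ≤ D.collBound (2 * (lh : ℝ) + 1) lstar j e) :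
    procAvg lh (fun j => D.wavg (j + 1) (vol j)) ≤
      ((2 * (lh : ℝ) + 1) + 1) / 4 * ((1 + 4 / (2 * (lh : ℝ) + 1)) * D.avg D.logDK
        - 1 / 6 * D.avg D.logQ + 4 / (2 * (lh : ℝ) + 1) * D.logp
        + 20 / 3 * (D.iota * lstar)) := by
  have hlh1 : 1 ≤ lh := by omega
  -- compare termwise with the weighted averages of the per-collection bounds
  have hle : procAvg lh (fun j => D.wavg (j + 1) (vol j)) ≤
      procAvg lh (fun j => D.wavg (j + 1) (D.collBound (2 * (lh : ℝ) + 1) lstar j)) := by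
    unfold procAvg
    apply mul_le_mul_of_nonneg_left _ (by positivity)
    refine Finset.sum_le_sum fun j hj => ?_
    rw [Finset.mem_Icc] at hj
    exact D.wavg_mono _ (hvol j hj.1 hj.2)
  refine le_trans hle ?_
  have e : (fun j => D.wavg (j + 1) (D.collBound (2 * (lh : ℝ) + 1) lstar j)) = fun j : ℕ =>
      ((j : ℝ) + 1) * D.avg D.logDK - (j : ℝ) ^ 2 / (2 * (2 * (lh : ℝ) + 1)) * D.avg D.logQ + D.logp
        + 4 * ((j : ℝ) + 1) * (D.iota * lstar) := by
    funext j; rw [D.wavg_collBound_eq]; ring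
  rw [e, procAvg_linear' hlh1]
  have hA : 0 ≤ D.avg D.logDK := by
    unfold avg betaAvg betaTotal
    exact div_nonneg (Finset.sum_nonneg fun v _ => mul_nonneg (D.logDK_nonneg v) (D.lam_pos v).le)
      (lamTotal_pos D.lam_pos).le
  have hl5 : (5 : ℝ) ≤ 2 * (lh : ℝ) + 1 := by
    have : (2 : ℝ) ≤ lh := by exact_mod_cast hlh
    linarith
  exact procNormalized_le (B := D.avg D.logQ) hl5 hA D.logp_nonneg (mul_nonneg D.iota_nonneg hlstar)

/-- **Step (v) at one distinguished `v_ℚ`, PRINTED FORM (p. 28, final display)**: the text's claim is the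
"weighted average upper bound" AFTER symmetrization — for each `j`, the `λ`-weighted average over collections
`e⃗ ∈ E^{j+1}` of the component volumes is `≤ (j+1)·log(𝔡^K_{v_ℚ}) − (j²/2l)·log(q_{v_ℚ}) + log(𝔰^ℚ_{v_ℚ}) +
4(j+1)·ι·l*_mod`; from it, the procession-normalized bound of Step (v). (This is the hypothesis shape that is
literally printed; whether it holds for the hull of the (Ind1)-symmetrized region is the question of
plan/c312/STEPV-IND1-NOTE.md — not judged here.) [claim: Mochizuki2012, status: disputed] -/
theorem procAvg_le_of_wavg_bounds {lh : ℕ} (hlh : 2 ≤ lh) {lstar : ℝ} (hlstar : 0 ≤ lstar)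
    (vol : (j : ℕ) → (Fin (j + 1) → E) → ℝ)
    (hwavg : ∀ j, 1 ≤ j → j ≤ lh → D.wavg (j + 1) (vol j) ≤
      ((j : ℝ) + 1) * D.avg D.logDK - (j : ℝ) ^ 2 / (2 * (2 * (lh : ℝ) + 1)) * D.avg D.logQ + D.logp
        + 4 * ((j : ℝ) + 1) * (D.iota * lstar)) :
    procAvg lh (fun j => D.wavg (j + 1) (vol j)) ≤
      ((2 * (lh : ℝ) + 1) + 1) / 4 * ((1 + 4 / (2 * (lh : ℝ) + 1)) * D.avg D.logDK
        - 1 / 6 * D.avg D.logQ + 4 / (2 * (lh : ℝ) + 1) * D.logp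
        + 20 / 3 * (D.iota * lstar)) := by
  have hlh1 : 1 ≤ lh := by omega
  have hle : procAvg lh (fun j => D.wavg (j + 1) (vol j)) ≤
      procAvg lh (fun j : ℕ => ((j : ℝ) + 1) * D.avg D.logDK
        - (j : ℝ) ^ 2 / (2 * (2 * (lh : ℝ) + 1)) * D.avg D.logQ + D.logp
        + 4 * ((j : ℝ) + 1) * (D.iota * lstar)) := by
    unfold procAvg
    apply mul_le_mul_of_nonneg_left _ (by positivity)
    refine Finset.sum_le_sum fun j hj => ?_
    rw [Finset.mem_Icc] at hj
    exact hwavg j hj.1 hj.2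
  refine le_trans hle ?_
  rw [procAvg_linear' hlh1]
  have hA : 0 ≤ D.avg D.logDK := by
    unfold avg betaAvg betaTotal
    exact div_nonneg (Finset.sum_nonneg fun v _ => mul_nonneg (D.logDK_nonneg v) (D.lam_pos v).le)
      (lamTotal_pos D.lam_pos).le
  have hl5 : (5 : ℝ) ≤ 2 * (lh : ℝ) + 1 := by
    have : (2 : ℝ) ≤ lh := by exact_mod_cast hlh
    linarith
  exact procNormalized_le (B := D.avg D.logQ) hl5 hA D.logp_nonneg (mul_nonneg D.iota_nonneg hlstar)

/-- The per-collection hypothesis implies the printed weighted-average hypothesis (Prop. 1.7: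
`wavg_collBound_eq`). [claim: Mochizuki2012, status: disputed] -/
theorem wavg_bound_of_collBound {lh : ℕ} (lstar : ℝ) (vol : (j : ℕ) → (Fin (j + 1) → E) → ℝ)
    (hvol : ∀ j, 1 ≤ j → j ≤ lh → ∀ e, vol j e ≤ D.collBound (2 * (lh : ℝ) + 1) lstar j e)
    (j : ℕ) (hj1 : 1 ≤ j) (hj2 : j ≤ lh) :
    D.wavg (j + 1) (vol j) ≤
      ((j : ℝ) + 1) * D.avg D.logDK - (j : ℝ) ^ 2 / (2 * (2 * (lh : ℝ) + 1)) * D.avg D.logQ + D.logp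
        + 4 * ((j : ℝ) + 1) * (D.iota * lstar) := by
  have h := D.wavg_mono _ (hvol j hj1 hj2)
  rw [D.wavg_collBound_eq] at h
  linarith

end DstLocal

/-! ## Step (viii), first sentence: the sum over `v_ℚ ∈ 𝕍_ℚ` (p. 30) -/

/-- Summing a fixed linear form over a finite index set. [folklore] -/
private theorem sum_lin {ι : Type*} (s : Finset ι) (a b p q : ι → ℝ) (c k₁ k₂ k₃ k₄ : ℝ) :
    ∑ v ∈ s, c * (k₁ * a v - k₂ * b v + k₃ * p v + k₄ * q v) =
      c * (k₁ * ∑ v ∈ s, a v - k₂ * ∑ v ∈ s, b v + k₃ * ∑ v ∈ s, p v + k₄ * ∑ v ∈ s, q v) := by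
  rw [Finset.mul_sum, Finset.mul_sum, Finset.mul_sum, Finset.mul_sum, ← Finset.sum_sub_distrib,
    ← Finset.sum_add_distrib, ← Finset.sum_add_distrib, Finset.mul_sum]

/-- **Steps (iv)–(viii) assembled at the level of real numbers.** Let `−|log(Θ)|` be bounded by the sum,
over the distinguished primes `v_ℚ ∈ 𝕍_ℚ^dst` (a finite set), of the procession-normalized weighted
averages of component volumes each bounded as in Step (v), plus a non-distinguished contribution `Z ≤ 0`
(Step (vi)), plus the procession-normalized archimedean bound `(1/l⋇)·Σ_j (j+1)·log(π)` (Step (vii)). Then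
`−|log(Θ)| ≤ (l+1)/4·{(1 + 4/l)·Σ_{v_ℚ} log(𝔡^K_{v_ℚ}) − (1/6)·Σ_{v_ℚ} log(q_{v_ℚ}) + (4/l)·Σ_{v_ℚ} log(𝔰^ℚ_{v_ℚ})
+ (20/3)·l*_mod·Σ_{v_ℚ} log(𝔰^≤_{v_ℚ})} + (l+5)/4·log(π)` ("it suffices to sum over `v_ℚ ∈ 𝕍_ℚ` the various
local “procession-normalized upper bounds” obtained in Steps (v), (vi), (vii)", p. 30) — the shape of
`Thm110Numerics.ProofData.hull_le`. [claim: Mochizuki2012, status: disputed] -/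
theorem hull_bound_of_local_bounds {ι : Type*} (dst : Finset ι) {E : ι → Type*}
    [∀ v, Fintype (E v)] [∀ v, Nonempty (E v)] (D : ∀ v, DstLocal (E v))
    {lh : ℕ} (hlh : 2 ≤ lh) {lstar : ℝ} (hlstar : 0 ≤ lstar) (logpi : ℝ)
    (vol : (v : ι) → (j : ℕ) → (Fin (j + 1) → E v) → ℝ)
    (hvol : ∀ v ∈ dst, ∀ j, 1 ≤ j → j ≤ lh → ∀ e,
      vol v j e ≤ (D v).collBound (2 * (lh : ℝ) + 1) lstar j e)
    {negLogTheta Z : ℝ} (hZ : Z ≤ 0)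
    (h : negLogTheta ≤ (∑ v ∈ dst, procAvg lh (fun j => (D v).wavg (j + 1) (vol v j))) + Z
      + procAvg lh (fun j => ((j : ℝ) + 1) * logpi)) :
    negLogTheta ≤
      ((2 * (lh : ℝ) + 1) + 1) / 4 * ((1 + 4 / (2 * (lh : ℝ) + 1)) * (∑ v ∈ dst, (D v).avg (D v).logDK)
        - 1 / 6 * (∑ v ∈ dst, (D v).avg (D v).logQ)
        + 4 / (2 * (lh : ℝ) + 1) * (∑ v ∈ dst, (D v).logp)
        + 20 / 3 * lstar * (∑ v ∈ dst, (D v).iota))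
      + ((2 * (lh : ℝ) + 1) + 5) / 4 * logpi := by
  have hlh1 : 1 ≤ lh := by omega
  have hsum : (∑ v ∈ dst, procAvg lh (fun j => (D v).wavg (j + 1) (vol v j))) ≤
      ∑ v ∈ dst, ((2 * (lh : ℝ) + 1) + 1) / 4 * ((1 + 4 / (2 * (lh : ℝ) + 1)) * (D v).avg (D v).logDK
        - 1 / 6 * (D v).avg (D v).logQ + 4 / (2 * (lh : ℝ) + 1) * (D v).logp
        + 20 / 3 * ((D v).iota * lstar)) :=
    Finset.sum_le_sum fun v hv => (D v).procAvg_wavg_le hlh hlstar (vol v) (hvol v hv)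
  rw [procAvg_arch hlh1] at h
  rw [sum_lin, ← Finset.sum_mul] at hsum
  linarith

/-- **Steps (v)–(viii), first sentence, PRINTED FORM**: as `hull_bound_of_local_bounds`, but from the printed
weighted-average hypothesis at each distinguished `v_ℚ` (see `DstLocal.procAvg_le_of_wavg_bounds`) instead of
the per-collection one. [claim: Mochizuki2012, status: disputed] -/
theorem hull_bound_of_wavg_bounds {ι : Type*} (dst : Finset ι) {E : ι → Type*}
    [∀ v, Fintype (E v)] [∀ v, Nonempty (E v)] (D : ∀ v, DstLocal (E v))
    {lh : ℕ} (hlh : 2 ≤ lh) {lstar : ℝ} (hlstar : 0 ≤ lstar) (logpi : ℝ)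
    (vol : (v : ι) → (j : ℕ) → (Fin (j + 1) → E v) → ℝ)
    (hwavg : ∀ v ∈ dst, ∀ j, 1 ≤ j → j ≤ lh → (D v).wavg (j + 1) (vol v j) ≤
      ((j : ℝ) + 1) * (D v).avg (D v).logDK - (j : ℝ) ^ 2 / (2 * (2 * (lh : ℝ) + 1)) * (D v).avg (D v).logQ
        + (D v).logp + 4 * ((j : ℝ) + 1) * ((D v).iota * lstar))
    {negLogTheta Z : ℝ} (hZ : Z ≤ 0)
    (h : negLogTheta ≤ (∑ v ∈ dst, procAvg lh (fun j => (D v).wavg (j + 1) (vol v j))) + Z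
      + procAvg lh (fun j => ((j : ℝ) + 1) * logpi)) :
    negLogTheta ≤
      ((2 * (lh : ℝ) + 1) + 1) / 4 * ((1 + 4 / (2 * (lh : ℝ) + 1)) * (∑ v ∈ dst, (D v).avg (D v).logDK)
        - 1 / 6 * (∑ v ∈ dst, (D v).avg (D v).logQ)
        + 4 / (2 * (lh : ℝ) + 1) * (∑ v ∈ dst, (D v).logp)
        + 20 / 3 * lstar * (∑ v ∈ dst, (D v).iota))
      + ((2 * (lh : ℝ) + 1) + 5) / 4 * logpi := by
  have hlh1 : 1 ≤ lh := by omega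
  have hsum : (∑ v ∈ dst, procAvg lh (fun j => (D v).wavg (j + 1) (vol v j))) ≤
      ∑ v ∈ dst, ((2 * (lh : ℝ) + 1) + 1) / 4 * ((1 + 4 / (2 * (lh : ℝ) + 1)) * (D v).avg (D v).logDK
        - 1 / 6 * (D v).avg (D v).logQ + 4 / (2 * (lh : ℝ) + 1) * (D v).logp
        + 20 / 3 * ((D v).iota * lstar)) :=
    Finset.sum_le_sum fun v hv => (D v).procAvg_le_of_wavg_bounds hlh hlstar (vol v) (hwavg v hv)
  rw [procAvg_arch hlh1] at h
  rw [sum_lin, ← Finset.sum_mul] at hsum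
  linarith

end Thm110Local

end Literature.IUT.LogVolume

end
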